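import Mathlib
import HarnessLib

/-!
# Zeros of exponential polynomials with polynomial coefficients lie in logarithmic strips

Zilber's Exponential-Algebraic Closedness, case ladder (host summit Schanuel, cell `pub-schanuel`,
seat 2, gen 5).  Analytic input for the density-from-growth principle
(`ZilberEacGrowthDensity.lean`).

**Theorem** (`abs_re_le_log_of_polyExp_zero`).  Let `H = ∑ₖ hₖ(s) tᵏ ∈ ℂ[s][t]` be nonzero and let
`z₀, z₁, … ∈ ℂ` with `‖z_m‖ → ∞` be zeros of the exponential polynomial `H(z, e^z) = ∑ₖ hₖ(z) e^{kz}`.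
Then for some constants `C, N` and all large `m`, `|Re z_m| ≤ C + N · log(1 + ‖z_m‖)` — the
classical fact (Pólya) that such zeros lie in logarithmic strips.

Proof.  Dividing out powers of `t` we may assume `h₀ ≠ 0`.  For large `m` the leading and
constant coefficients `h_K(z_m), h₀(z_m)` are bounded away from `0` (a nonconstant polynomial tends
to infinity) while every `hₖ(z_m)` is `O((1 + ‖z_m‖)^N)`; Cauchy's bound for the roots of
`H(z_m, ·)` and of its reverse gives `‖e^{z_m}‖, ‖e^{-z_m}‖ ≤ C (1 + ‖z_m‖)^N`.

Honest framing: folklore analysis; nothing about `EC(3,2)` (OPEN) or Schanuel's conjecture is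
asserted here.
-/

noncomputable section

open Polynomial Filter

set_option linter.dupNamespace false

namespace Summit.Schanuel.Schanuel.Theorems

/-! ## Polynomial growth -/

/-- A complex polynomial grows at most like `(1 + ‖x‖)^{deg}`:
`‖q(x)‖ ≤ (∑ⱼ ‖qⱼ‖) (1 + ‖x‖)^{natDegree q}`. [folklore] -/
theorem norm_eval_le_pow (q : Polynomial ℂ) (x : ℂ) :
    ‖q.eval x‖ ≤ (∑ j ∈ Finset.range (q.natDegree + 1), ‖q.coeff j‖) * (1 + ‖x‖) ^ q.natDegree := by
  rw [eval_eq_sum_range, Finset.sum_mul]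
  refine (norm_sum_le _ _).trans (Finset.sum_le_sum fun j hj => ?_)
  rw [Finset.mem_range] at hj
  rw [norm_mul, norm_pow]
  refine mul_le_mul_of_nonneg_left ?_ (norm_nonneg _)
  calc ‖x‖ ^ j ≤ (1 + ‖x‖) ^ j :=
        pow_le_pow_left₀ (norm_nonneg _) (by linarith [norm_nonneg x]) j
    _ ≤ (1 + ‖x‖) ^ q.natDegree :=
        pow_le_pow_right₀ (by linarith [norm_nonneg x]) (by omega)

/-- **Uniform growth of the coefficients of `H ∈ ℂ[s][t]`**: one pair `(B, N)` with
`‖hₖ(x)‖ ≤ B (1 + ‖x‖)^N` for every `k`. [folklore] -/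
theorem exists_norm_coeff_eval_le (H : Polynomial (Polynomial ℂ)) :
    ∃ B : ℝ, 0 ≤ B ∧ ∃ N : ℕ, ∀ k (x : ℂ), ‖(H.coeff k).eval x‖ ≤ B * (1 + ‖x‖) ^ N := by
  classical
  set N := H.support.sup fun k => (H.coeff k).natDegree with hN
  set B := ∑ k ∈ H.support, ∑ j ∈ Finset.range ((H.coeff k).natDegree + 1), ‖(H.coeff k).coeff j‖
    with hB
  refine ⟨B, Finset.sum_nonneg fun k _ => Finset.sum_nonneg fun j _ => norm_nonneg _, N,
    fun k x => ?_⟩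
  by_cases hk : k ∈ H.support
  · have h1 := norm_eval_le_pow (H.coeff k) x
    have hx1 : 1 ≤ 1 + ‖x‖ := by linarith [norm_nonneg x]
    have h2 : (1 + ‖x‖) ^ (H.coeff k).natDegree ≤ (1 + ‖x‖) ^ N :=
      pow_le_pow_right₀ hx1 (Finset.le_sup (f := fun k => (H.coeff k).natDegree) hk)
    have h3 : (∑ j ∈ Finset.range ((H.coeff k).natDegree + 1), ‖(H.coeff k).coeff j‖) ≤ B :=
      Finset.single_le_sum (f := fun k => ∑ j ∈ Finset.range ((H.coeff k).natDegree + 1),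
        ‖(H.coeff k).coeff j‖) (fun k _ => Finset.sum_nonneg fun j _ => norm_nonneg _) hk
    calc ‖(H.coeff k).eval x‖
        ≤ (∑ j ∈ Finset.range ((H.coeff k).natDegree + 1), ‖(H.coeff k).coeff j‖) *
            (1 + ‖x‖) ^ (H.coeff k).natDegree := h1
      _ ≤ B * (1 + ‖x‖) ^ N :=
          mul_le_mul h3 h2 (pow_nonneg (by linarith [norm_nonneg x]) _)
            (Finset.sum_nonneg fun k _ => Finset.sum_nonneg fun j _ => norm_nonneg _)
  · rw [Polynomial.notMem_support_iff.1 hk, eval_zero, norm_zero]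
    exact mul_nonneg (Finset.sum_nonneg fun k _ => Finset.sum_nonneg fun j _ => norm_nonneg _)
      (pow_nonneg (by linarith [norm_nonneg x]) _)

/-- Along a sequence going to infinity, a nonzero polynomial is eventually bounded away from zero.
[folklore] -/
theorem eventually_le_norm_eval {q : Polynomial ℂ} (hq : q ≠ 0) {z : ℕ → ℂ}
    (hz : Tendsto (fun m => ‖z m‖) atTop atTop) :
    ∃ c : ℝ, 0 < c ∧ ∀ᶠ m in atTop, c ≤ ‖q.eval (z m)‖ := by
  by_cases hdeg : 0 < q.degree
  · refine ⟨1, one_pos, ?_⟩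
    exact (Polynomial.tendsto_norm_atTop q hdeg hz).eventually_ge_atTop 1
  · have hq' : q = C (q.coeff 0) := eq_C_of_degree_le_zero (not_lt.1 hdeg)
    have hc : q.coeff 0 ≠ 0 := by
      intro h; apply hq; rw [hq', h, map_zero]
    refine ⟨‖q.coeff 0‖, norm_pos_iff.2 hc, Eventually.of_forall fun m => ?_⟩
    rw [hq', eval_C, coeff_C_zero]

/-! ## A root bound -/

/-- **Root bound** (Cauchy): if every non-leading coefficient of `p ≠ 0` has norm `≤ M` and the
leading coefficient has norm `≥ c > 0`, every root has norm `≤ natDegree p * M / c + 1`.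
[folklore] -/
theorem norm_root_le_of_coeff_le {p : Polynomial ℂ} (hp : p ≠ 0) {M c : ℝ} (hM : 0 ≤ M) (hc : 0 < c)
    (hcoeff : ∀ i, i < p.natDegree → ‖p.coeff i‖ ≤ M) (hlead : c ≤ ‖p.leadingCoeff‖)
    {w : ℂ} (hw : p.IsRoot w) : ‖w‖ ≤ p.natDegree * M / c + 1 := by
  set K := p.natDegree with hK
  have hKMc : 0 ≤ (K : ℝ) * M / c := div_nonneg (mul_nonneg (Nat.cast_nonneg _) hM) hc.le
  by_cases hw1 : ‖w‖ ≤ 1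
  · linarith
  push Not at hw1
  -- `K ≥ 1`: a nonzero constant has no roots
  have hKpos : 0 < K := by
    by_contra hle
    push Not at hle
    have hpC := eq_C_of_natDegree_eq_zero (Nat.le_zero.1 hle)
    rw [hpC, IsRoot.def, eval_C] at hw
    apply hp
    rw [hpC, hw, map_zero]
  -- `a_K w^K = -∑_{i<K} a_i w^i`
  have hsum : p.leadingCoeff * w ^ K = -∑ i ∈ Finset.range K, p.coeff i * w ^ i := by
    have h := hw
    rw [IsRoot.def, eval_eq_sum_range, Finset.sum_range_succ] at h
    rw [Polynomial.leadingCoeff, ← hK]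
    linear_combination h
  have hwK1 : ∀ i, i < K → ‖w‖ ^ i ≤ ‖w‖ ^ (K - 1) := fun i hi =>
    pow_le_pow_right₀ hw1.le (by omega)
  have hnorm : ‖p.leadingCoeff‖ * ‖w‖ ^ K ≤ K * M * ‖w‖ ^ (K - 1) := by
    calc ‖p.leadingCoeff‖ * ‖w‖ ^ K = ‖p.leadingCoeff * w ^ K‖ := by rw [norm_mul, norm_pow]
      _ = ‖∑ i ∈ Finset.range K, p.coeff i * w ^ i‖ := by rw [hsum, norm_neg]
      _ ≤ ∑ i ∈ Finset.range K, ‖p.coeff i * w ^ i‖ := norm_sum_le _ _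
      _ ≤ ∑ i ∈ Finset.range K, M * ‖w‖ ^ (K - 1) := by
          refine Finset.sum_le_sum fun i hi => ?_
          rw [Finset.mem_range] at hi
          rw [norm_mul, norm_pow]
          exact mul_le_mul (hcoeff i hi) (hwK1 i hi) (pow_nonneg (norm_nonneg _) _) hM
      _ = K * M * ‖w‖ ^ (K - 1) := by
          rw [Finset.sum_const, Finset.card_range, nsmul_eq_mul]; ring
  -- divide by `‖w‖^{K-1} > 0`
  have hwpos : 0 < ‖w‖ := by linarith
  have hpow : ‖w‖ ^ K = ‖w‖ ^ (K - 1) * ‖w‖ := by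
    rw [← pow_succ, Nat.sub_add_cancel hKpos]
  rw [hpow, ← mul_assoc] at hnorm
  have hpk : 0 < ‖w‖ ^ (K - 1) := pow_pos hwpos _
  have h1 : ‖p.leadingCoeff‖ * ‖w‖ ≤ K * M := by
    have := le_of_mul_le_mul_right (by linarith [hnorm] :
      ‖p.leadingCoeff‖ * ‖w‖ * ‖w‖ ^ (K - 1) ≤ K * M * ‖w‖ ^ (K - 1)) hpk
    exact this
  have h2 : c * ‖w‖ ≤ K * M :=
    (mul_le_mul_of_nonneg_right hlead hwpos.le).trans h1
  have h3 : ‖w‖ ≤ K * M / c := by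
    rw [le_div_iff₀ hc]; linarith [mul_comm c ‖w‖]
  linarith

/-! ## The logarithmic strip -/

/-- **Zeros of `∑ₖ hₖ(z) e^{kz}` along a divergent sequence have `|Re z| = O(log ‖z‖)`** — case of a
nonzero constant coefficient `h₀`. [folklore] -/
theorem abs_re_le_log_of_polyExp_zero_aux (H : Polynomial (Polynomial ℂ)) (hH : H ≠ 0)
    (h0 : H.coeff 0 ≠ 0) {z : ℕ → ℂ} (hz : Tendsto (fun m => ‖z m‖) atTop atTop)
    (hroot : ∀ m, (H.map (Polynomial.evalRingHom (z m))).eval (Complex.exp (z m)) = 0) :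
    ∃ C : ℝ, ∃ N : ℕ, ∀ᶠ m in atTop, |(z m).re| ≤ C + N * Real.log (1 + ‖z m‖) := by
  obtain ⟨B, hB, N, hBN⟩ := exists_norm_coeff_eval_le H
  obtain ⟨c₁, hc₁, hev₁⟩ := eventually_le_norm_eval (leadingCoeff_ne_zero.2 hH) hz
  obtain ⟨c₀, hc₀, hev₀⟩ := eventually_le_norm_eval h0 hz
  set K := H.natDegree with hK
  -- the constant: `log (K * B / c + 1)` for `c = min c₀ c₁`
  set c := min c₀ c₁ with hc
  have hcpos : 0 < c := lt_min hc₀ hc₁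
  set A : ℝ := K * B / c + 1 with hA
  have hA1 : 1 ≤ A := by
    have : 0 ≤ (K : ℝ) * B / c := div_nonneg (mul_nonneg (Nat.cast_nonneg _) hB) hcpos.le
    linarith
  refine ⟨Real.log A, N, ?_⟩
  filter_upwards [hev₁, hev₀] with m hm₁ hm₀
  set x := z m with hx
  set w := Complex.exp x with hw
  set Hx := H.map (Polynomial.evalRingHom x) with hHx
  have hx1 : 1 ≤ 1 + ‖x‖ := by linarith [norm_nonneg x]
  have hx0 : (0 : ℝ) ≤ 1 + ‖x‖ := by linarith [norm_nonneg x]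
  have hlc : (Polynomial.evalRingHom x) H.leadingCoeff ≠ 0 := by
    rw [Polynomial.coe_evalRingHom]
    exact norm_pos_iff.1 (hc₁.trans_le hm₁)
  have hdeg : Hx.natDegree = K := natDegree_map_of_leadingCoeff_ne_zero _ hlc
  have hlead : Hx.leadingCoeff = H.leadingCoeff.eval x := by
    rw [hHx, leadingCoeff_map_of_leadingCoeff_ne_zero _ hlc, Polynomial.coe_evalRingHom]
  have hHx0 : Hx ≠ 0 := by
    intro h
    rw [← leadingCoeff_eq_zero, hlead] at h
    exact norm_pos_iff.1 (hc₁.trans_le hm₁) h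
  have hcoeffx : ∀ i, Hx.coeff i = (H.coeff i).eval x := fun i => by
    rw [hHx, coeff_map, Polynomial.coe_evalRingHom]
  have hc0x : Hx.coeff 0 ≠ 0 := by
    rw [hcoeffx]; exact norm_pos_iff.1 (hc₀.trans_le hm₀)
  -- all coefficients of `Hx` are `≤ B (1+‖x‖)^N`
  have hbd : ∀ i, ‖Hx.coeff i‖ ≤ B * (1 + ‖x‖) ^ N := fun i => by rw [hcoeffx]; exact hBN i x
  -- UPPER: `‖e^x‖ ≤ A (1+‖x‖)^N`
  have hroot' : Hx.IsRoot w := hroot m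
  have hup : ‖w‖ ≤ A * (1 + ‖x‖) ^ N := by
    have h1 := norm_root_le_of_coeff_le hHx0 (mul_nonneg hB (pow_nonneg hx0 _)) hcpos
      (fun i _ => hbd i) (by rw [hlead]; exact (min_le_right _ _).trans hm₁) hroot'
    rw [hdeg] at h1
    calc ‖w‖ ≤ K * (B * (1 + ‖x‖) ^ N) / c + 1 := h1
      _ ≤ A * (1 + ‖x‖) ^ N := by
          rw [hA, add_mul, one_mul]
          have hp1 : 1 ≤ (1 + ‖x‖) ^ N := one_le_pow₀ hx1
          have : (K : ℝ) * (B * (1 + ‖x‖) ^ N) / c = K * B / c * (1 + ‖x‖) ^ N := by ring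
          rw [this]
          linarith
  -- LOWER: the reverse polynomial has the root `w⁻¹ = e^{-x}`
  have hlow : ‖w⁻¹‖ ≤ A * (1 + ‖x‖) ^ N := by
    haveI : Invertible w := invertibleOfNonzero (Complex.exp_ne_zero x)
    have hrev : (Hx.reverse).IsRoot w⁻¹ := by
      rw [IsRoot.def, ← invOf_eq_inv, eval, eval₂_reverse_eq_zero_iff]
      exact hroot'
    have hrev0 : Hx.reverse ≠ 0 := by rwa [ne_eq, reverse_eq_zero]
    have hntd : Hx.natTrailingDegree = 0 := natTrailingDegree_eq_zero.2 (Or.inr hc0x)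
    have hrlead : Hx.reverse.leadingCoeff = Hx.coeff 0 := by
      rw [reverse_leadingCoeff, trailingCoeff, hntd]
    have hrdeg : Hx.reverse.natDegree ≤ K := (reverse_natDegree_le Hx).trans hdeg.le
    have h1 := norm_root_le_of_coeff_le hrev0 (mul_nonneg hB (pow_nonneg hx0 _)) hcpos
      (fun i _ => by rw [coeff_reverse]; exact hbd _)
      (by rw [hrlead, hcoeffx]; exact (min_le_left _ _).trans hm₀) hrev
    calc ‖w⁻¹‖ ≤ Hx.reverse.natDegree * (B * (1 + ‖x‖) ^ N) / c + 1 := h1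
      _ ≤ K * (B * (1 + ‖x‖) ^ N) / c + 1 := by
          gcongr
      _ ≤ A * (1 + ‖x‖) ^ N := by
          rw [hA, add_mul, one_mul]
          have hp1 : 1 ≤ (1 + ‖x‖) ^ N := one_le_pow₀ hx1
          have : (K : ℝ) * (B * (1 + ‖x‖) ^ N) / c = K * B / c * (1 + ‖x‖) ^ N := by ring
          rw [this]
          linarith
  -- logarithms
  have hApos : 0 < A * (1 + ‖x‖) ^ N := mul_pos (by linarith) (pow_pos (by linarith) _)
  have hlogA : Real.log (A * (1 + ‖x‖) ^ N) = Real.log A + N * Real.log (1 + ‖x‖) := by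
    rw [Real.log_mul (by positivity) (pow_ne_zero _ (by positivity)), Real.log_pow]
  have hre_up : x.re ≤ Real.log A + N * Real.log (1 + ‖x‖) := by
    have := Real.log_le_log (Complex.exp_ne_zero x |> norm_pos_iff.2) hup
    rwa [Complex.norm_exp, Real.log_exp, hlogA] at this
  have hre_low : -x.re ≤ Real.log A + N * Real.log (1 + ‖x‖) := by
    have hwinv : ‖w⁻¹‖ = Real.exp (-x.re) := by
      rw [norm_inv, hw, Complex.norm_exp, Real.exp_neg]
    have := Real.log_le_log (by rw [hwinv]; exact Real.exp_pos _) hlow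
    rwa [hwinv, Real.log_exp, hlogA] at this
  exact abs_le.2 ⟨by linarith, hre_up⟩

/-- **Zeros of exponential polynomials lie in logarithmic strips.**  For `H ∈ ℂ[s][t]` nonzero and
zeros `z_m` (`‖z_m‖ → ∞`) of `z ↦ H(z, e^z)`: eventually `|Re z_m| ≤ C + N log(1 + ‖z_m‖)`.
[folklore] -/
theorem abs_re_le_log_of_polyExp_zero (H : Polynomial (Polynomial ℂ)) (hH : H ≠ 0)
    {z : ℕ → ℂ} (hz : Tendsto (fun m => ‖z m‖) atTop atTop)
    (hroot : ∀ m, (H.map (Polynomial.evalRingHom (z m))).eval (Complex.exp (z m)) = 0) :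
    ∃ C : ℝ, ∃ N : ℕ, ∀ᶠ m in atTop, |(z m).re| ≤ C + N * Real.log (1 + ‖z m‖) := by
  -- induction on the `t`-degree, dividing out `t` while the constant coefficient vanishes
  induction hd : H.natDegree using Nat.strong_induction_on generalizing H with
  | _ d ih =>
    by_cases h0 : H.coeff 0 ≠ 0
    · exact abs_re_le_log_of_polyExp_zero_aux H hH h0 hz hroot
    · push Not at h0
      have hsplit : H.divX * X = H := by
        have := divX_mul_X_add H
        rwa [h0, map_zero, add_zero] at this
      have hdiv0 : H.divX ≠ 0 := by
        intro h; apply hH; rw [← hsplit, h, zero_mul]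
      have hdpos : 0 < H.natDegree := by
        by_contra hle
        push Not at hle
        have := eq_C_of_natDegree_eq_zero (Nat.le_zero.1 hle)
        rw [h0, map_zero] at this
        exact hH this
      have hlt : H.divX.natDegree < d := by
        rw [natDegree_divX_eq_natDegree_tsub_one, ← hd]; omega
      refine ih _ hlt H.divX hdiv0 (fun m => ?_) rfl
      have := hroot m
      rw [← hsplit, Polynomial.map_mul, Polynomial.map_X, eval_mul, eval_X] at this
      exact (mul_eq_zero.1 this).resolve_right (Complex.exp_ne_zero _)

end Summit.Schanuel.Schanuel.Theorems
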